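import Literature.NumberTheory.Rogawski1990.ArchBouazizRegularGerms          -- ★ p851525 (this seat): `bzLocalSurjRegular_of_parts`
import Literature.NumberTheory.Rogawski1990.ArchBouazizClassTube             -- ★ p851533 (LH3-p04 (g5)): `mem_regS_of_sq_ne_four_mul`, `exists_forall_chart_eq_of_dist_bzClassMap_lt`, `abs_coord_zero_le_log_of_dist_bzClassMap_lt`
import Literature.NumberTheory.Rogawski1990.ArchBouazizClassMapClosedRange   -- ★ p851511 (F0P3a-p09 (g8)): `isClosed_range_bzClassMap`
import Literature.NumberTheory.Rogawski1990.ArchBouazizClassDescentPaid     -- ★ p851569 (LH10-p02 (g7)): `exists_classDescent` (over ★ p851556∕p851561 LH3-p03 (g6), ★ p851534, ★ p851524)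
import HarnessLib

/-!
# (Σ-REG) PAID — local surjectivity of `fH ↦ stOrbFamH L νH fH` onto Bouaziz's space at every base class REGULAR at every place, in local-equality form, hypothesis-free at
# the frame `(L, νH, jcH)` of the SURJ-OF-FORWARD assembly (Bouaziz 1994 §5.1 «dans un bon voisinage de chaque élément semi-simple» — the regular half; Varadarajan 1989 §6.2)

Topic `NumberTheory/Rogawski1990`; namespace `Literature.NumberTheory.Rogawski1990`.  THEOREMS ONLY (no `def`, no instance, no notation, no axiom, no named fact, no `sorry`).
Cell `pub/hodgecm-mathlib`, crux H413 (`stmt-HodgeConjecture-24833`), line LH3 (closer stub `stub_N9`, DIRECT ROAD), letter L3′ = `BouazizSurjectiveStatement`, split FORWARD (★ p851464) ⊕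
SURJ-OF-FORWARD (RULING #22); SURJ binder LH10-p01 (g5): ★ `bouazizSurjOfForward_of_reg_wall (L νH jcH) (hreg) (hwall)` (p851508).  THIS FILE PAYS `hreg` BY A BARE NAME:
**`bzLocalSurjRegular (L νH) (jcH) (hfwd) : ∀ b, (∀ w, (b w).1 ^ 2 ≠ 4 * (b w).2.1) → ∃ ε > 0, ∀ Ψ ∈ ArchBouazizSpaceH jcH, ∃ fH ∈ C_c^∞(H_∞), ∀ S c, c ∈ RegS S →
dist (bzClassMap S c) b < ε → stOrbFamH L νH fH S c = Ψ S c`** (`hfwd` = the forward half, in the leaf payer's context) = ★ `bzLocalSurjRegular_of_parts` (p851525) with its five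
group-free inputs discharged BY BARE NAMES: (g1)(T2)(T3) ★ p851533, (img) ★ p851511, (Σ4c) ★ `exists_classDescent` (p851569; = the (Σ-REG) interface of F0P3a-p04 (g25)
12:51:49Z (2) token for token).  (The twin route through ★ p851553 `bzLocalSurjRegular_of_section` + ★ p851561 `exists_contDiffOn_section_bzClassMap₃` is equivalent.)
THE ROAD «CLASS-FUNCTION MULTIPLIER» (S-ROAD CENSUS v1 LH10-p01 (g5); (Σ-REG) binder F0P3a-p04 (g25); carve 12:57Z∕13:02Z), all ★: (Σ4a)∕(Σ-MULT) p851490 `ArchBouazizClassMultiplier`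
(F0P3a-p04) · (Σ4b) p851507 `ArchBouazizPositiveTestFunction` (F0P3a-p04) · (Σ4d) p851525 `ArchBouazizRegularGerms` + p851553 `…OfSection` (F0P3a-p04) · (Σ4d-geo) p851533
`ArchBouazizClassTube` (LH3-p04 (g5)) · (Σ4-img) p851511 `ArchBouazizClassMapClosedRange` (F0P3a-p09 (g8)) · (Σ4c) p851515 `…ClassMapFibre` + p851524 `…ClassDescent` (LH10-p02 (g7)),
p851534 `…ChartDescent` (LH3-p03 (g6) ∕ LH10-p02 (g7)), p851543 `Analysis/Calculus/SimpleRootBranch` (F0P3a-p04), p851556 `…ClassMapSectionPlace` + p851561 `…ClassMapSection`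
(LH3-p03 (g6)).
HONEST LABEL: with this file SURJ-OF-FORWARD (hence L3′, hence `stub_N9`'s Bouaziz letter) hinges on exactly ONE organ, (Σ-WALL) = `hwall` (local surjectivity at a base class with a
central block; in-house W-road censused by LH3-p01 (g6), v1 6129001bfae4ccc0) — L3′ stays PRINT-labelled until that is ★; HC_CM is proved only modulo the 7 printed citations
(2 remaining: hLiu418 = stmt-HodgeConjecture-24832, h413 = stmt-HodgeConjecture-24833) until rung 0 closes; count-neutral.

## References
* [Bouaziz1994IntegralesOrbitales] A. Bouaziz, *Intégrales orbitales sur les groupes de Lie réductifs*, Ann. Sci. ÉNS (4) 27 (1994) 573–609, §5.1 p. 588, Thm. 6.2.1 (i) p. 592.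
* [Varadarajan1989] V. S. Varadarajan, *An Introduction to Harmonic Analysis on Semisimple Lie Groups*, Cambridge Stud. Adv. Math. 16 (1989), §6.2.
-/

set_option autoImplicit false

noncomputable section

open MeasureTheory NumberField NumberField.InfinitePlace Complex Set Function Filter Topology
open Literature.NumberTheory.Automorphic Literature.NumberTheory.Automorphic.UnitaryGroup Literature.NumberTheory.Automorphic.ArchCartan
open scoped Classical ContDiff

namespace Literature.NumberTheory.Rogawski1990

section Paid

variable (L : Type) [Field L] [NumberField L] [IsCMField L]
  [MeasurableSpace (↥(arch (↥(maximalRealSubfield L)) L (IsCMField.complexConj L) 2 (Matrix.of fun i j : Fin 2 => if i.val + j.val + 1 = 2 then (1 : L) else 0)) ×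
      ↥(arch (↥(maximalRealSubfield L)) L (IsCMField.complexConj L) 1 (Matrix.of fun i j : Fin 1 => if i.val + j.val + 1 = 1 then (1 : L) else 0)))]
  [BorelSpace (↥(arch (↥(maximalRealSubfield L)) L (IsCMField.complexConj L) 2 (Matrix.of fun i j : Fin 2 => if i.val + j.val + 1 = 2 then (1 : L) else 0)) ×
      ↥(arch (↥(maximalRealSubfield L)) L (IsCMField.complexConj L) 1 (Matrix.of fun i j : Fin 1 => if i.val + j.val + 1 = 1 then (1 : L) else 0)))]
  (νH : Measure (↥(arch (↥(maximalRealSubfield L)) L (IsCMField.complexConj L) 2 (Matrix.of fun i j : Fin 2 => if i.val + j.val + 1 = 2 then (1 : L) else 0)) ×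
      ↥(arch (↥(maximalRealSubfield L)) L (IsCMField.complexConj L) 1 (Matrix.of fun i j : Fin 1 => if i.val + j.val + 1 = 1 then (1 : L) else 0))))
  [νH.IsHaarMeasure] [νH.IsMulRightInvariant]

/-- **(Σ-REG) PAID — LOCAL SURJECTIVITY AT A BASE CLASS REGULAR AT EVERY PLACE**: the `hreg` organ of ★ `bouazizSurjOfForward_of_reg_wall` (p851508) at the frame `(L, νH, jcH)`,
from the forward half `hfwd` alone: ★ `bzLocalSurjRegular_of_parts` (p851525) with its five inputs discharged by ★ names ((Σ4d-geo) p851533, (Σ4-img) p851511, (Σ4c)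
`exists_classDescent` p851569). [cite: Bouaziz1994IntegralesOrbitales, §5.1 p. 588; Thm. 6.2.1 (i) p. 592] [cite: Varadarajan1989, §6.2] -/
theorem bzLocalSurjRegular
    (jcH : Finset {w : InfinitePlace L // IsComplex w} → {w : InfinitePlace L // IsComplex w} → ℂ)
    (hfwd : ∀ fH : ↥(arch (↥(maximalRealSubfield L)) L (IsCMField.complexConj L) 2 (Matrix.of fun i j : Fin 2 => if i.val + j.val + 1 = 2 then (1 : L) else 0)) ×
        ↥(arch (↥(maximalRealSubfield L)) L (IsCMField.complexConj L) 1 (Matrix.of fun i j : Fin 1 => if i.val + j.val + 1 = 1 then (1 : L) else 0)) → ℂ,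
      ArchSmooth₂ L fH → ArchBouazizSpaceH jcH (stOrbFamH L νH fH))
    (b : {w : InfinitePlace L // IsComplex w} → ℂ × ℂ × ℂ) (hb : ∀ w, (b w).1 ^ 2 ≠ 4 * (b w).2.1) :
    ∃ ε : ℝ, 0 < ε ∧
      ∀ Ψ : Finset {w : InfinitePlace L // IsComplex w} → ({w : InfinitePlace L // IsComplex w} → Fin 3 → ℝ) → ℂ, ArchBouazizSpaceH jcH Ψ →
        ∃ fH : ↥(arch (↥(maximalRealSubfield L)) L (IsCMField.complexConj L) 2 (Matrix.of fun i j : Fin 2 => if i.val + j.val + 1 = 2 then (1 : L) else 0)) ×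
            ↥(arch (↥(maximalRealSubfield L)) L (IsCMField.complexConj L) 1 (Matrix.of fun i j : Fin 1 => if i.val + j.val + 1 = 1 then (1 : L) else 0)) → ℂ,
          ArchSmooth₂ L fH ∧ ∀ (S : Finset {w : InfinitePlace L // IsComplex w}) (c : {w : InfinitePlace L // IsComplex w} → Fin 3 → ℝ),
            c ∈ RegS S → dist (bzClassMap S c) b < ε → stOrbFamH L νH fH S c = Ψ S c :=
  bzLocalSurjRegular_of_parts L νH (fun S c h => mem_regS_of_sq_ne_four_mul S c h) (fun b hb => exists_forall_chart_eq_of_dist_bzClassMap_lt b hb)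
    (fun S c b ε w hw h => abs_coord_zero_le_log_of_dist_bzClassMap_lt S c b ε w hw h) (fun S => isClosed_range_bzClassMap S)
    (fun S _ hc₀ Φ _ hε₀ hΦP hΦW hΦX hΦs hΦ0 => exists_classDescent S hc₀ Φ hε₀ hΦP hΦW hΦX hΦs hΦ0) jcH hfwd b hb

end Paid

end Literature.NumberTheory.Rogawski1990

end
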